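import Mathlib
import Summits.ResolutionOfSingularities.ResolutionOfSingularities.Theorems.HomologicalConductorPersistenceSurfaceSaturationResidualFour
import HarnessLib

/-!
# Rung S-2 `PersistenceSurface` (stmt-ResolutionOfSingularities-19970) — the level-free transfers L-other′ / L₄′ / L₄R♮′
# REDUCE TO THE STEPS INTO A SINGULAR STAGE (from a two-dimensional stage)

Route `ResolutionOfSingularities/HomologicalConductor`, chain W4.4b, rung S-2 `PersistenceSurface`
(stmt-ResolutionOfSingularities-19970), registered skeleton 1a77c002, stub
`stub_levelFourPersistenceNonnormalOrNonrational' : LevelFourPersistenceNonnormalOrNonrational'` (L-other′: on the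
class Σ6 ∪ Σ8 — stage `0` not normal-rational-or-regular — `ca⁴(T_m) ⊆ ca(T_(m+1))` for every `m`).
[OURS · bookkeeping over LANDED tree lemmas; AI-written, weaker than expert review; NOT a statement of the manuscript
under study (Hironaka 2017).]  DEF-FREE: no new `def`, no conjecture; hypotheses spelled inline.

The twin, for the level-free TRANSFER statements, of the «last-singular-step exemption» of
`…PersistenceSurfaceSaturationResidualFour` (Sat side) and of `completedStepPersistenceRationalNormal'_of_singularSteps`
(`…CompletedStepLevelFreeSingular`, CSP‴): the step `ca⁴(T_m) ⊆ ca(T_(m+1))` is free when the TARGET stage `T_(m+1)` is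
a regular local ring — `ca(T_(m+1)) = T_(m+1) ⊇ T_m ⊇ ca⁴(T_m)` — and `T_(m+1)` IS regular unless `T_m` has Krull
dimension exactly `2` (`isRegularLocalRing_succ_of_ringKrullDim_le_one`, `ringKrullDim_eq_two_of_not_isRegularLocalRing_succ`).

* `caAt_subset_ca_succ_of_isRegularLocalRing_succ` — `T_(m+1)` regular ⇒ `caAt n (T_m) ⊆ ca (T_(m+1))` (any level `n`);
* `levelFourPersistenceNonnormalOrNonrational'_of_singularSucc` — L-other′ follows from its restriction to the steps
  `m` with `T_(m+1)` NOT regular and `ringKrullDim ↥(T_m) = 2` (both offered to the prover as hypotheses);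
* `levelFourPersistenceSurface'_of_singularSucc`, `levelFourPersistenceRationalNormal'_of_singularSucc` — the same
  for `LevelFourPersistenceSurface'` and `LevelFourPersistenceRationalNormal'`.

So the content of the stub L-other′ is: for a surface tower whose stage `0` is NOT (normal with a rational singularity,
or regular), at every TWO-dimensional stage `T_m` whose successor is SINGULAR, `ca⁴(T_m) ⊆ ca(T_(m+1))`.  Nothing is
asserted about that class here.

References (mechanism only): S. B. Iyengar, R. Takahashi, IMRN 2016, Example 2.5 (`ca` of a regular ring is the unit
ideal) [`IyengarTakahashi2014`]; H. Matsumura, *Commutative Ring Theory*, Thm. 11.7 (Krull–Akizuki)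
[`Matsumura1987`] — both only through landed tree lemmas.
-/

noncomputable section

-- single-problem summit: the doubled namespace component `ResolutionOfSingularities` is forced
set_option linter.dupNamespace false

namespace Summit.ResolutionOfSingularities.ResolutionOfSingularities.Theorems.HomologicalConductor.PersistenceSurfaceLevelFreeRestSingular

open Summit.ResolutionOfSingularities.ResolutionOfSingularities.Theorems
open Summit.ResolutionOfSingularities.ResolutionOfSingularities.Theorems.NoZeno.Birth
open Summit.ResolutionOfSingularities.ResolutionOfSingularities.Theorems.HomologicalConductor.PersistenceDimOne
open Summit.ResolutionOfSingularities.ResolutionOfSingularities.Theorems.HomologicalConductor.PersistenceSurfaceCompletedStepLevelFree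
open Summit.ResolutionOfSingularities.ResolutionOfSingularities.Theorems.HomologicalConductor.PersistenceSurfaceSaturationResidualFour

variable {k K : Type} [Field k] [Field K] [Algebra k K]

/-! ## A regular successor closes the level-free step -/

/-- **A regular successor closes the level-free transfer step**: if `T_(m+1)` is a regular local ring then
`caAt n (T_m) ⊆ ca (T_(m+1))` for every level `n` — `caAt n (T_m) ⊆ T_m ≤ T_(m+1) = ca(T_(m+1))`
(`PersistenceDimOne.ca_eq_self_of_isRegularLocalRing`). [cite: IyengarTakahashi2014, Example 2.5] -/
theorem caAt_subset_ca_succ_of_isRegularLocalRing_succ (O : ValuationSubring K) (A : Subalgebra k K) (m n : ℕ)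
    (hreg : IsRegularLocalRing ↥(tower O A (m + 1))) :
    {x : K | ∃ hx : x ∈ tower O A m, ∀ i : ℕ, n ≤ i → ∀ (M N : ModuleCat.{0} ↥(tower O A m)),
        Module.Finite ↥(tower O A m) M → Module.Finite ↥(tower O A m) N →
          ∀ e : CategoryTheory.Abelian.Ext.{0} M N i, (⟨x, hx⟩ : ↥(tower O A m)) • e = 0} ⊆
      ca (tower O A (m + 1)) := by
  rintro x ⟨hxT, -⟩
  rw [ca_eq_self_of_isRegularLocalRing (tower O A (m + 1)) hreg]
  rw [tower_succ]
  exact SyzygyFlattening.self_le_locAt O _ (SyzygyFlattening.self_le_nrm _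
    (Algebra.subset_adjoin (Or.inl hxT)))

/-! ## The level-free transfers from their restriction to singular successors -/

/-- **L-other′ reduces to the steps into a SINGULAR stage from a two-dimensional stage.**  If, on the class
«stage `0` NOT (normal with a rational singularity, or regular)», `ca⁴(T_m) ⊆ ca(T_(m+1))` holds at every step `m`
with `T_(m+1)` NOT regular and `ringKrullDim ↥(T_m) = 2`, then `LevelFourPersistenceNonnormalOrNonrational'` holds:
a regular successor closes the step (`caAt_subset_ca_succ_of_isRegularLocalRing_succ`), and a singular successor
forces `dim T_m = 2` (`ringKrullDim_eq_two_of_not_isRegularLocalRing_succ`). [cite: Matsumura1987, Thm. 11.7] -/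
theorem levelFourPersistenceNonnormalOrNonrational'_of_singularSucc
    (h : ∀ p : ℕ, p.Prime → ∀ (k K : Type) [Field k] [CharP k p] [Field K] [Algebra k K]
      (O : ValuationSubring K) (A : Subalgebra k K), (∀ c : k, algebraMap k K c ∈ O) → A.FG →
      IsFractionRing ↥A K → A.toSubring ≤ O.toSubring → ringKrullDim ↥A ≤ 2 →
      ¬ ((IsIntegrallyClosed ↥(tower O A 0) ∧
          Literature.AlgebraicGeometry.Resolution.HasRationalSingularity ↥(tower O A 0)) ∨
        IsRegularLocalRing ↥(tower O A 0)) →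
      ∀ m : ℕ, ¬ IsRegularLocalRing ↥(tower O A (m + 1)) → ringKrullDim ↥(tower O A m) = (2 : ℕ) →
      {x : K | ∃ hx : x ∈ tower O A m, ∀ i : ℕ, 4 ≤ i → ∀ (M N : ModuleCat.{0} ↥(tower O A m)),
          Module.Finite ↥(tower O A m) M → Module.Finite ↥(tower O A m) N →
            ∀ e : CategoryTheory.Abelian.Ext.{0} M N i, (⟨x, hx⟩ : ↥(tower O A m)) • e = 0} ⊆
        ca (tower O A (m + 1))) :
    LevelFourPersistenceNonnormalOrNonrational' := by
  intro p hp k K _ _ _ _ O A hk hA hfr hAO hdim caAt ca loc chart nrm tower hN m x hx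
  by_cases hsucc : IsRegularLocalRing ↥(NoZeno.Birth.tower O A (m + 1))
  · exact caAt_subset_ca_succ_of_isRegularLocalRing_succ O A m 4 hsucc hx
  · exact h p hp k K O A hk hA hfr hAO hdim hN m hsucc
      (ringKrullDim_eq_two_of_not_isRegularLocalRing_succ hp O A hk hA hfr hAO hdim m hsucc) hx

/-- **L₄′ reduces to the steps into a SINGULAR stage from a two-dimensional stage**: the same reduction for
`LevelFourPersistenceSurface'` (no class hypothesis on stage `0`). [cite: Matsumura1987, Thm. 11.7] -/
theorem levelFourPersistenceSurface'_of_singularSucc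
    (h : ∀ p : ℕ, p.Prime → ∀ (k K : Type) [Field k] [CharP k p] [Field K] [Algebra k K]
      (O : ValuationSubring K) (A : Subalgebra k K), (∀ c : k, algebraMap k K c ∈ O) → A.FG →
      IsFractionRing ↥A K → A.toSubring ≤ O.toSubring → ringKrullDim ↥A ≤ 2 →
      ∀ m : ℕ, ¬ IsRegularLocalRing ↥(tower O A (m + 1)) → ringKrullDim ↥(tower O A m) = (2 : ℕ) →
      {x : K | ∃ hx : x ∈ tower O A m, ∀ i : ℕ, 4 ≤ i → ∀ (M N : ModuleCat.{0} ↥(tower O A m)),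
          Module.Finite ↥(tower O A m) M → Module.Finite ↥(tower O A m) N →
            ∀ e : CategoryTheory.Abelian.Ext.{0} M N i, (⟨x, hx⟩ : ↥(tower O A m)) • e = 0} ⊆
        ca (tower O A (m + 1))) :
    LevelFourPersistenceSurface' := by
  intro p hp k K _ _ _ _ O A hk hA hfr hAO hdim caAt ca loc chart nrm tower m x hx
  by_cases hsucc : IsRegularLocalRing ↥(NoZeno.Birth.tower O A (m + 1))
  · exact caAt_subset_ca_succ_of_isRegularLocalRing_succ O A m 4 hsucc hx
  · exact h p hp k K O A hk hA hfr hAO hdim m hsucc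
      (ringKrullDim_eq_two_of_not_isRegularLocalRing_succ hp O A hk hA hfr hAO hdim m hsucc) hx

/-- **L₄R♮′ reduces to the steps into a SINGULAR stage from a two-dimensional stage**: the same reduction for
`LevelFourPersistenceRationalNormal'` (class (R♮): stage `0` normal with a rational singularity, or regular).
[cite: Matsumura1987, Thm. 11.7] -/
theorem levelFourPersistenceRationalNormal'_of_singularSucc
    (h : ∀ p : ℕ, p.Prime → ∀ (k K : Type) [Field k] [CharP k p] [Field K] [Algebra k K]
      (O : ValuationSubring K) (A : Subalgebra k K), (∀ c : k, algebraMap k K c ∈ O) → A.FG →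
      IsFractionRing ↥A K → A.toSubring ≤ O.toSubring → ringKrullDim ↥A ≤ 2 →
      ((IsIntegrallyClosed ↥(tower O A 0) ∧
          Literature.AlgebraicGeometry.Resolution.HasRationalSingularity ↥(tower O A 0)) ∨
        IsRegularLocalRing ↥(tower O A 0)) →
      ∀ m : ℕ, ¬ IsRegularLocalRing ↥(tower O A (m + 1)) → ringKrullDim ↥(tower O A m) = (2 : ℕ) →
      {x : K | ∃ hx : x ∈ tower O A m, ∀ i : ℕ, 4 ≤ i → ∀ (M N : ModuleCat.{0} ↥(tower O A m)),
          Module.Finite ↥(tower O A m) M → Module.Finite ↥(tower O A m) N →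
            ∀ e : CategoryTheory.Abelian.Ext.{0} M N i, (⟨x, hx⟩ : ↥(tower O A m)) • e = 0} ⊆
        ca (tower O A (m + 1))) :
    LevelFourPersistenceRationalNormal' := by
  intro p hp k K _ _ _ _ O A hk hA hfr hAO hdim caAt ca loc chart nrm tower hRN m x hx
  by_cases hsucc : IsRegularLocalRing ↥(NoZeno.Birth.tower O A (m + 1))
  · exact caAt_subset_ca_succ_of_isRegularLocalRing_succ O A m 4 hsucc hx
  · exact h p hp k K O A hk hA hfr hAO hdim hRN m hsucc
      (ringKrullDim_eq_two_of_not_isRegularLocalRing_succ hp O A hk hA hfr hAO hdim m hsucc) hx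

end Summit.ResolutionOfSingularities.ResolutionOfSingularities.Theorems.HomologicalConductor.PersistenceSurfaceLevelFreeRestSingular

end
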